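import Literature.Geometry.DiscreteGeometry.ConvexHullFacets
import Literature.Geometry.DiscreteGeometry.PolygonalConeVertices
import Literature.Geometry.DiscreteGeometry.SphericalCodeVertexStar
import HarnessLib

/-!
# Euler's formula for the convex hull of a spherical code (Legendre's Gauss–Bonnet proof)

Topic `Literature/Geometry/DiscreteGeometry`.  Brick C₂ of the face theory of spherical
subdivisions behind Musin–Tarasov 2012 §3 (Prop. 3.4: "using Euler's formula") and Fejes
Tóth's bounds (`2N − 4` Delaunay triangles): for a finite set `X ⊂ S² ⊂ ℝ³` of unit vectors
with `0` in the interior of `conv X` — every Tammes-optimal arrangement of `N ≥ 7` points is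
such (`SphericalCodeBalanced.lean`) — the boundary complex of the polytope `conv X` projects
radially to a tiling of the sphere by convex spherical polygons (the spherical Delaunay
subdivision of `X`: facets ↔ empty circumscribed caps), and

**Theorem** (`sum_card_tightSet_eq`, Legendre 1794 / Euler 1752).
`Σ_{facets f} #vertices(f) = 2·#X + 2·#facets − 4`,
i.e. with `I = Σ_f m_f` incidences (`= 2E`): `N − I/2 + F = 2`.  Corollaries:
`#facets ≤ 2N − 4` with equality iff all facets are triangles (`card_facetNormals_le`,
`card_facetNormals_eq_of_simplicial`), `I ≤ 6N − 12` (`sum_card_tightSet_le`).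

Proof (Legendre's): the cones over the facets tile space, so their solid angles sum to `4π`
(`ConeTiling.sum_ballFraction_argmaxCone`); each facet `f` with `m_f` vertices is a convex
spherical polygon of area `Σ_v θ_{f,v} − (m_f − 2)π` (Girard, `ballFraction_polyCone` in the
vertex-wedge form `PolygonalConeVertices.ballFraction_polyCone_eq_sum_dirCone`); and at each
vertex `v ∈ X` the angles `θ_{f,v}` of the facets through `v` sum to `2π`
(`ConeTiling.sum_ballFraction_dirCone_argmaxCone`).  Summing: `4π = 2π N − π(I − 2F)`.

The geometric input specific to the sphere (this file): the vertices of a facet of `conv X`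
are COCIRCULAR (`⟪c, y⟫ = 1`, `‖y‖ = 1`), so sorting them by azimuth about the facet axis
`c/‖c‖` (`facetVertex`, via `SphericalCodeVertexStar.azimuth`; the sign `facetSign` fixes the
handedness of the frame) enumerates them in convex position — all cyclically ordered triples
positively oriented (`orient3_facetVertex_pos`, from the explicit formula
`det = κ(1−κ²)·(sin(θ₂−θ₁) + sin(θ₃−θ₂) − sin(θ₃−θ₁))·det(frame)`, `orient3_of_tight`, and
`sin A + sin B − sin(A+B) = 4 sin(A/2) sin(B/2) sin((A+B)/2) > 0`) — hence the facet cone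
`argmaxCone (facetNormals X) c` IS the polygonal cone `polyCone m (facetVertex X c _)` of
`SphericalPolygonArea.lean` (`argmaxCone_eq_polyCone`) and Girard applies.  Also:
`orient3_sq_eq_gram` (Lagrange: `det[u;v;w]² = det Gram(u,v,w)`), `orient3_orthonormalBasis_sq`
(`= 1`), `one_lt_norm_of_mem_facetNormals`.

Everything is PROVED; no named facts.  Not here: the edge count `I = 2E` (edges of the
subdivision as a separate notion), and Euler for the coarser CONTACT graph of Musin–Tarasov
(faces = unions of Delaunay facets), which needs their Props. 3.4–3.5 on top.

## References
* A.-M. Legendre, *Éléments de géométrie* (1794), Livre VII, Prop. XXV. [folklore]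
* L. Euler, *Elementa doctrinae solidorum*, Novi Comm. Acad. Sci. Petrop. 4 (1752/58). [folklore]
* O. R. Musin, A. S. Tarasov, *The strong thirteen spheres problem*, DCG 48 (2012), §3,
  Prop. 3.1 (planarity of the contact graph), Prop. 3.4 (Euler). [`MusinTarasov2012`]
* L. Fejes Tóth, *Lagerungen in der Ebene, auf der Kugel und im Raum*, Springer 1953, V §3
  (`2N − 4` triangles). [folklore]
-/

noncomputable section

namespace Literature.Geometry.DiscreteGeometry

open Real RealInnerProductSpace MeasureTheory Metric Set InnerProductGeometry

local notation "E3" => EuclideanSpace ℝ (Fin 3)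

/-! ### Part 1. Determinant identities and a trigonometric inequality -/

section Algebra

/-- The inner product of `ℝ³` in coordinates. [folklore] -/
theorem inner_eq_sum_coord (x y : E3) : ⟪x, y⟫ = x 0 * y 0 + x 1 * y 1 + x 2 * y 2 := by
  simp [PiLp.inner_apply, Fin.sum_univ_three]; ring

/-- **Lagrange's identity for the triple product**: `det[u;v;w]²` is the Gram determinant of
`u, v, w`. [folklore] -/
theorem orient3_sq_eq_gram (u v w : E3) :
    orient3 u v w ^ 2 =
      ⟪u, u⟫ * ⟪v, v⟫ * ⟪w, w⟫ + 2 * ⟪u, v⟫ * ⟪v, w⟫ * ⟪w, u⟫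
        - ⟪u, u⟫ * ⟪v, w⟫ ^ 2 - ⟪v, v⟫ * ⟪u, w⟫ ^ 2 - ⟪w, w⟫ * ⟪u, v⟫ ^ 2 := by
  simp only [orient3, inner_eq_sum_coord]
  ring

/-- **An orthonormal frame has determinant `±1`.** [folklore] -/
theorem orient3_orthonormalBasis_sq (b : OrthonormalBasis (Fin 3) ℝ E3) :
    orient3 (b 0) (b 1) (b 2) ^ 2 = 1 := by
  have h := orthonormal_iff_ite.1 b.orthonormal
  rw [orient3_sq_eq_gram]
  simp [h]

/-- … in particular it is nonzero. [folklore] -/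
theorem orient3_orthonormalBasis_ne_zero (b : OrthonormalBasis (Fin 3) ℝ E3) :
    orient3 (b 0) (b 1) (b 2) ≠ 0 := by
  intro h
  have := orient3_orthonormalBasis_sq b
  rw [h] at this
  norm_num at this

/-- **The determinant of three points of a circle about the frame axis.**  In an arbitrary
frame `b₀, b₁, b₂` of `ℝ³`, three combinations with the same `b₂`-coefficient `r` have
`det = r · (twice the signed area of the planar triangle of their `(b₀, b₁)`-parts) · det(b)`.
[folklore] -/
theorem orient3_frame_combination (b₀ b₁ b₂ : E3) (p₁ q₁ p₂ q₂ p₃ q₃ r : ℝ) :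
    orient3 (p₁ • b₀ + q₁ • b₁ + r • b₂) (p₂ • b₀ + q₂ • b₁ + r • b₂)
        (p₃ • b₀ + q₃ • b₁ + r • b₂) =
      r * ((p₂ * q₃ - q₂ * p₃) - (p₁ * q₃ - q₁ * p₃) + (p₁ * q₂ - q₁ * p₂)) *
        orient3 b₀ b₁ b₂ := by
  simp only [orient3, PiLp.add_apply, PiLp.smul_apply, smul_eq_mul]
  ring

/-- `sin A + sin B − sin (A + B) = 4 sin(A/2) sin(B/2) sin((A+B)/2)`. [folklore] -/
theorem sin_add_sin_sub_sin_add (A B : ℝ) :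
    sin A + sin B - sin (A + B) = 4 * sin (A / 2) * sin (B / 2) * sin ((A + B) / 2) := by
  have hA : A = 2 * (A / 2) := by ring
  have hB : B = 2 * (B / 2) := by ring
  have hAB : (A + B) / 2 = A / 2 + B / 2 := by ring
  conv_lhs => rw [hA, hB, show 2 * (A / 2) + 2 * (B / 2) = 2 * (A / 2) + 2 * (B / 2) from rfl]
  rw [hAB, sin_add (A / 2), sin_add (2 * (A / 2)), sin_two_mul, sin_two_mul, cos_two_mul,
    cos_two_mul]
  have h1 := sin_sq_add_cos_sq (A / 2)
  have h2 := sin_sq_add_cos_sq (B / 2)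
  linear_combination (-4 * sin (A / 2) * cos (A / 2)) * h2 + (-4 * sin (B / 2) * cos (B / 2)) * h1

/-- **Three points of a circle in angular order are positively oriented**: for
`θ₁ < θ₂ < θ₃ < θ₁ + 2π`, `sin(θ₂−θ₁) + sin(θ₃−θ₂) − sin(θ₃−θ₁) > 0`. [folklore] -/
theorem circleDet_pos {θ₁ θ₂ θ₃ : ℝ} (h12 : θ₁ < θ₂) (h23 : θ₂ < θ₃) (h31 : θ₃ < θ₁ + 2 * π) :
    0 < sin (θ₂ - θ₁) + sin (θ₃ - θ₂) - sin (θ₃ - θ₁) := by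
  have h := sin_add_sin_sub_sin_add (θ₂ - θ₁) (θ₃ - θ₂)
  rw [show θ₂ - θ₁ + (θ₃ - θ₂) = θ₃ - θ₁ by ring] at h
  rw [h]
  have s1 : 0 < sin ((θ₂ - θ₁) / 2) := sin_pos_of_pos_of_lt_pi (by linarith) (by linarith)
  have s2 : 0 < sin ((θ₃ - θ₂) / 2) := sin_pos_of_pos_of_lt_pi (by linarith) (by linarith)
  have s3 : 0 < sin ((θ₃ - θ₁) / 2) := sin_pos_of_pos_of_lt_pi (by linarith) (by linarith)
  positivity

/-- The circle determinant is odd, in the form `S(t) = σ · S(σ t)` for `σ = ±1`. [folklore] -/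
theorem circleDet_signed (σ θ₁ θ₂ θ₃ : ℝ) (hσ : σ = 1 ∨ σ = -1) :
    sin (θ₂ - θ₁) + sin (θ₃ - θ₂) - sin (θ₃ - θ₁) =
      σ * (sin (σ * θ₂ - σ * θ₁) + sin (σ * θ₃ - σ * θ₂) - sin (σ * θ₃ - σ * θ₁)) := by
  rcases hσ with rfl | rfl
  · simp only [one_mul]
  · rw [show -1 * θ₂ - -1 * θ₁ = -(θ₂ - θ₁) by ring, show -1 * θ₃ - -1 * θ₂ = -(θ₃ - θ₂) by ring,
      show -1 * θ₃ - -1 * θ₁ = -(θ₃ - θ₁) by ring, sin_neg, sin_neg, sin_neg]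
    ring

end Algebra

/-! ### Part 2. Facets of the hull of a spherical code: axis, frame, azimuths -/

section Facets

variable {X : Finset E3}

/-- **Facet normals of a spherical code have norm `> 1`** (the facet plane `⟪c, ·⟫ = 1` cuts
the unit sphere in a circle of positive radius `√(1 − ‖c‖⁻²)`). [folklore] -/
theorem one_lt_norm_of_mem_facetNormals (hX1 : ∀ y ∈ X, ‖y‖ = 1) {c : E3}
    (hc : c ∈ facetNormals X) : 1 < ‖c‖ := by
  have hcF := mem_facetNormals.1 hc
  -- the tight set is nonempty
  have hne : (tightSet X c).Nonempty := by
    rw [Finset.nonempty_iff_ne_empty]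
    intro he
    have h2 := hcF.2
    rw [he, Finset.coe_empty, Submodule.span_empty] at h2
    exact bot_ne_top h2
  obtain ⟨y₀, hy₀⟩ := hne
  have hy₀X := (mem_tightSet.1 hy₀).1
  have hy₀1 := (mem_tightSet.1 hy₀).2
  have hge : 1 ≤ ‖c‖ := by
    have := real_inner_le_norm c y₀
    rw [hy₀1, hX1 y₀ hy₀X, mul_one] at this
    exact this
  refine lt_of_le_of_ne hge fun heq => ?_
  -- if `‖c‖ = 1` every tight point equals `c`, so the tight set cannot span
  have hsub : ((tightSet X c : Finset E3) : Set E3) ⊆ {c} := by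
    intro y hy
    have hy' := mem_tightSet.1 (Finset.mem_coe.1 hy)
    rw [Set.mem_singleton_iff]
    exact ((inner_eq_one_iff_of_norm_eq_one heq.symm (hX1 y hy'.1)).1 hy'.2).symm
  have hspan : Submodule.span ℝ ((tightSet X c : Finset E3) : Set E3) ≤ ℝ ∙ c :=
    Submodule.span_mono hsub
  rw [hcF.2, top_le_iff] at hspan
  have hc0 : c ≠ 0 := fun h => by rw [h, norm_zero] at heq; exact one_ne_zero heq
  have h1 : Module.finrank ℝ (ℝ ∙ c) = 1 := finrank_span_singleton hc0
  rw [hspan, finrank_top, finrank_euclideanSpace_fin] at h1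
  norm_num at h1

/-- Facet normals of a spherical code are nonzero. [folklore] -/
theorem ne_zero_of_mem_facetNormals (hX1 : ∀ y ∈ X, ‖y‖ = 1) {c : E3}
    (hc : c ∈ facetNormals X) : c ≠ 0 := fun h => by
  have := one_lt_norm_of_mem_facetNormals hX1 hc
  rw [h, norm_zero] at this
  exact (lt_irrefl (0 : ℝ)) (lt_trans zero_lt_one this)

/-- A facet of the hull of a spherical code in `ℝ³` has at least three vertices. [folklore] -/
theorem three_le_card_tightSet {c : E3} (hc : c ∈ facetNormals X) : 3 ≤ (tightSet X c).card := by
  have := (mem_facetNormals.1 hc).finrank_le_card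
  rwa [finrank_euclideanSpace_fin] at this

/-- **The facet axis** `c/‖c‖`. [folklore] -/
def facetAxis (c : E3) : E3 := ‖c‖⁻¹ • c

/-- The facet axis is a unit vector. [folklore] -/
theorem norm_facetAxis {c : E3} (hc : c ≠ 0) : ‖facetAxis c‖ = 1 := by
  rw [facetAxis, norm_smul, norm_inv, norm_norm, inv_mul_cancel₀ (norm_ne_zero_iff.2 hc)]

/-- Tight points lie at level `κ = ‖c‖⁻¹` about the facet axis. [folklore] -/
theorem inner_facetAxis_of_tight {c y : E3} (hy : ⟪c, y⟫ = 1) : ⟪facetAxis c, y⟫ = ‖c‖⁻¹ := by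
  rw [facetAxis, real_inner_smul_left, hy, mul_one]

/-- **The facet frame**: an orthonormal basis `b₀, b₁, b₂` of `ℝ³` with `b₂ = c/‖c‖`
(`SphericalCodeVertexStar.tangentFrame`). [folklore] -/
def facetFrame (c : E3) (hc : c ≠ 0) : OrthonormalBasis (Fin 3) ℝ E3 :=
  tangentFrame (facetAxis c) (norm_facetAxis hc)

/-- **The handedness of the facet frame**: `+1` if `det[b₀; b₁; b₂] > 0`, else `−1`.
[folklore] -/
def facetSign (c : E3) (hc : c ≠ 0) : ℝ :=
  if 0 < orient3 (facetFrame c hc 0) (facetFrame c hc 1) (facetFrame c hc 2) then 1 else -1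

/-- `facetSign = 1 ∨ facetSign = −1`. [folklore] -/
theorem facetSign_eq_or (c : E3) (hc : c ≠ 0) : facetSign c hc = 1 ∨ facetSign c hc = -1 := by
  unfold facetSign; split_ifs <;> simp

/-- `facetSign² = 1`. [folklore] -/
theorem facetSign_mul_self (c : E3) (hc : c ≠ 0) : facetSign c hc * facetSign c hc = 1 := by
  rcases facetSign_eq_or c hc with h | h <;> rw [h] <;> norm_num

/-- `|facetSign| = 1`. [folklore] -/
theorem abs_facetSign (c : E3) (hc : c ≠ 0) : |facetSign c hc| = 1 := by
  rcases facetSign_eq_or c hc with h | h <;> rw [h] <;> norm_num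

/-- **The signed frame determinant is positive**: `facetSign · det[b₀; b₁; b₂] > 0`.
[folklore] -/
theorem facetSign_mul_orient3_pos (c : E3) (hc : c ≠ 0) :
    0 < facetSign c hc *
      orient3 (facetFrame c hc 0) (facetFrame c hc 1) (facetFrame c hc 2) := by
  have hne := orient3_orthonormalBasis_ne_zero (facetFrame c hc)
  unfold facetSign
  split_ifs with h
  · rwa [one_mul]
  · rw [neg_one_mul, neg_pos]
    exact lt_of_le_of_ne (not_lt.1 h) hne

/-- **The signed azimuth** of `y` about the facet axis (counter-clockwise in a positively
oriented frame). [folklore] -/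
def signedAzimuth (c : E3) (hc : c ≠ 0) (y : E3) : ℝ :=
  facetSign c hc * azimuth (facetAxis c) (norm_facetAxis hc) y

/-- Two signed azimuths differ by less than `2π`. [folklore] -/
theorem signedAzimuth_sub_lt (c : E3) (hc : c ≠ 0) (y y' : E3) :
    signedAzimuth c hc y - signedAzimuth c hc y' < 2 * π := by
  have h1 := neg_pi_lt_azimuth (facetAxis c) (norm_facetAxis hc) y
  have h2 := azimuth_le_pi (facetAxis c) (norm_facetAxis hc) y
  have h3 := neg_pi_lt_azimuth (facetAxis c) (norm_facetAxis hc) y'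
  have h4 := azimuth_le_pi (facetAxis c) (norm_facetAxis hc) y'
  unfold signedAzimuth
  rcases facetSign_eq_or c hc with h | h <;> rw [h] <;> linarith

/-- **Tight points with the same signed azimuth coincide** (they lie on one circle).
[folklore] -/
theorem eq_of_signedAzimuth_eq (hX1 : ∀ y ∈ X, ‖y‖ = 1) {c : E3} (hc : c ≠ 0) {y y' : E3}
    (hy : y ∈ tightSet X c) (hy' : y' ∈ tightSet X c)
    (h : signedAzimuth c hc y = signedAzimuth c hc y') : y = y' := by
  have hy1 := mem_tightSet.1 hy
  have hy'1 := mem_tightSet.1 hy'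
  unfold signedAzimuth at h
  have hσ : facetSign c hc ≠ 0 := fun h0 => by
    have := abs_facetSign c hc; rw [h0, abs_zero] at this; exact zero_ne_one this
  have h' := mul_left_cancel₀ hσ h
  exact eq_of_azimuth_eq (hv := norm_facetAxis hc) (hX1 y hy1.1) (hX1 y' hy'1.1)
    (inner_facetAxis_of_tight hy1.2) (inner_facetAxis_of_tight hy'1.2) h'

/-- **A tight point in the facet frame**: `y = ρ cos θ · b₀ + ρ sin θ · b₁ + κ · b₂` with
`κ = ‖c‖⁻¹`, `ρ = √(1 − κ²)`, `θ` the (unsigned) azimuth. [folklore] -/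
theorem tight_eq_frame_combination (hX1 : ∀ y ∈ X, ‖y‖ = 1) {c : E3} (hc : c ≠ 0) {y : E3}
    (hy : y ∈ tightSet X c) :
    y = (Real.sqrt (1 - ‖c‖⁻¹ ^ 2) * cos (azimuth (facetAxis c) (norm_facetAxis hc) y)) •
          facetFrame c hc 0 +
        (Real.sqrt (1 - ‖c‖⁻¹ ^ 2) * sin (azimuth (facetAxis c) (norm_facetAxis hc) y)) •
          facetFrame c hc 1 +
        ‖c‖⁻¹ • facetFrame c hc 2 := by
  have hy1 := mem_tightSet.1 hy
  have hκ : ⟪facetAxis c, y⟫ = ‖c‖⁻¹ := inner_facetAxis_of_tight hy1.2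
  obtain ⟨hXc, hYc⟩ := inner_frame_eq_polar (hv := norm_facetAxis hc) (hX1 y hy1.1) hκ
  have h2 : ⟪facetFrame c hc 2, y⟫ = ‖c‖⁻¹ := by
    rw [facetFrame, tangentFrame_two, hκ]
  conv_lhs => rw [← (facetFrame c hc).sum_repr' y]
  rw [Fin.sum_univ_three, h2]
  rw [facetFrame] at *
  rw [hXc, hYc]

/-- **The determinant of three tight points** in terms of their azimuths `θᵢ`:
`det[y₁;y₂;y₃] = κ (1 − κ²) (sin(θ₂−θ₁) + sin(θ₃−θ₂) − sin(θ₃−θ₁)) · det[b₀;b₁;b₂]`.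
[folklore] -/
theorem orient3_of_tight (hX1 : ∀ y ∈ X, ‖y‖ = 1) {c : E3} (hc : c ≠ 0) {y₁ y₂ y₃ : E3}
    (h₁ : y₁ ∈ tightSet X c) (h₂ : y₂ ∈ tightSet X c) (h₃ : y₃ ∈ tightSet X c) :
    orient3 y₁ y₂ y₃ =
      ‖c‖⁻¹ * (1 - ‖c‖⁻¹ ^ 2) *
        (sin (azimuth (facetAxis c) (norm_facetAxis hc) y₂ - azimuth (facetAxis c) (norm_facetAxis hc) y₁) +
          sin (azimuth (facetAxis c) (norm_facetAxis hc) y₃ - azimuth (facetAxis c) (norm_facetAxis hc) y₂) -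
          sin (azimuth (facetAxis c) (norm_facetAxis hc) y₃ - azimuth (facetAxis c) (norm_facetAxis hc) y₁)) *
        orient3 (facetFrame c hc 0) (facetFrame c hc 1) (facetFrame c hc 2) := by
  have hκ1 : ‖c‖⁻¹ ^ 2 ≤ 1 := by
    have h := mem_tightSet.1 h₁
    have hle : ‖c‖⁻¹ ≤ 1 := by
      have := abs_real_inner_le_norm (facetAxis c) y₁
      rw [inner_facetAxis_of_tight h.2, norm_facetAxis hc, hX1 y₁ h.1, one_mul] at this
      exact le_trans (le_abs_self _) this
    have h0 : 0 ≤ ‖c‖⁻¹ := inv_nonneg.2 (norm_nonneg c)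
    nlinarith
  have hρ : Real.sqrt (1 - ‖c‖⁻¹ ^ 2) ^ 2 = 1 - ‖c‖⁻¹ ^ 2 := Real.sq_sqrt (by linarith)
  conv_lhs => rw [tight_eq_frame_combination hX1 hc h₁, tight_eq_frame_combination hX1 hc h₂,
    tight_eq_frame_combination hX1 hc h₃]
  rw [orient3_frame_combination]
  set ρ := Real.sqrt (1 - ‖c‖⁻¹ ^ 2)
  set t₁ := azimuth (facetAxis c) (norm_facetAxis hc) y₁
  set t₂ := azimuth (facetAxis c) (norm_facetAxis hc) y₂
  set t₃ := azimuth (facetAxis c) (norm_facetAxis hc) y₃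
  rw [sin_sub, sin_sub, sin_sub, ← hρ]
  ring

/-- **The sorted signed azimuths of the tight points of a facet.** [folklore] -/
def facetAngles (X : Finset E3) (c : E3) (hc : c ≠ 0) : Finset ℝ :=
  (tightSet X c).image (signedAzimuth c hc)

/-- There are as many facet angles as tight points. [folklore] -/
theorem card_facetAngles (hX1 : ∀ y ∈ X, ‖y‖ = 1) {c : E3} (hc : c ≠ 0) :
    (facetAngles X c hc).card = (tightSet X c).card :=
  Finset.card_image_of_injOn fun _ hy _ hy' h => eq_of_signedAzimuth_eq hX1 hc hy hy' h

/-- Each sorted angle is the signed azimuth of a tight point. [folklore] -/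
theorem exists_mem_tightSet_signedAzimuth_eq (X : Finset E3) (c : E3) (hc : c ≠ 0)
    (i : Fin (facetAngles X c hc).card) :
    ∃ y ∈ tightSet X c, signedAzimuth c hc y = (facetAngles X c hc).orderEmbOfFin rfl i := by
  have := (facetAngles X c hc).orderEmbOfFin_mem rfl i
  unfold facetAngles at this
  rw [Finset.mem_image] at this
  obtain ⟨y, hy, he⟩ := this
  exact ⟨y, hy, he⟩

/-- **The vertices of the facet of `c` in counter-clockwise order** (indices `< #tight set`;
`0` beyond). [folklore] -/
def facetVertex (X : Finset E3) (c : E3) (hc : c ≠ 0) (i : ℕ) : E3 :=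
  if h : i < (facetAngles X c hc).card then
    Classical.choose (exists_mem_tightSet_signedAzimuth_eq X c hc ⟨i, h⟩)
  else 0

/-- The facet vertices are tight points … [folklore] -/
theorem facetVertex_mem {c : E3} (hc : c ≠ 0) {i : ℕ} (hi : i < (facetAngles X c hc).card) :
    facetVertex X c hc i ∈ tightSet X c := by
  rw [facetVertex, dif_pos hi]
  exact (Classical.choose_spec (exists_mem_tightSet_signedAzimuth_eq X c hc ⟨i, hi⟩)).1

/-- … with the sorted signed azimuths … [folklore] -/
theorem signedAzimuth_facetVertex {c : E3} (hc : c ≠ 0) {i : ℕ}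
    (hi : i < (facetAngles X c hc).card) :
    signedAzimuth c hc (facetVertex X c hc i) = (facetAngles X c hc).orderEmbOfFin rfl ⟨i, hi⟩ := by
  rw [facetVertex, dif_pos hi]
  exact (Classical.choose_spec (exists_mem_tightSet_signedAzimuth_eq X c hc ⟨i, hi⟩)).2

/-- … strictly increasing in the index. [folklore] -/
theorem signedAzimuth_facetVertex_lt {c : E3} (hc : c ≠ 0) {i j : ℕ} (hij : i < j)
    (hj : j < (facetAngles X c hc).card) :
    signedAzimuth c hc (facetVertex X c hc i) < signedAzimuth c hc (facetVertex X c hc j) := by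
  rw [signedAzimuth_facetVertex hc (lt_trans hij hj), signedAzimuth_facetVertex hc hj]
  exact ((facetAngles X c hc).orderEmbOfFin rfl).strictMono (Fin.mk_lt_mk.2 hij)

/-- Every tight point is a facet vertex. [folklore] -/
theorem exists_facetVertex_eq (hX1 : ∀ y ∈ X, ‖y‖ = 1) {c : E3} (hc : c ≠ 0) {y : E3}
    (hy : y ∈ tightSet X c) : ∃ i, i < (facetAngles X c hc).card ∧ facetVertex X c hc i = y := by
  have hmem : signedAzimuth c hc y ∈ Set.range ((facetAngles X c hc).orderEmbOfFin rfl) := by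
    rw [Finset.range_orderEmbOfFin, Finset.mem_coe]
    exact Finset.mem_image_of_mem _ hy
  obtain ⟨i, hi⟩ := hmem
  refine ⟨i, i.2, eq_of_signedAzimuth_eq hX1 hc (facetVertex_mem hc i.2) hy ?_⟩
  rw [signedAzimuth_facetVertex hc i.2, ← hi]

/-- **The facet vertices enumerate the tight set.** [folklore] -/
theorem image_facetVertex (hX1 : ∀ y ∈ X, ‖y‖ = 1) {c : E3} (hc : c ≠ 0) :
    facetVertex X c hc '' Set.Iio (facetAngles X c hc).card = ((tightSet X c : Finset E3) : Set E3) := by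
  ext y
  constructor
  · rintro ⟨i, hi, rfl⟩
    exact Finset.mem_coe.2 (facetVertex_mem hc hi)
  · intro hy
    obtain ⟨i, hi, rfl⟩ := exists_facetVertex_eq hX1 hc (Finset.mem_coe.1 hy)
    exact ⟨i, hi, rfl⟩

/-- The same for `Finset.range`. [folklore] -/
theorem image_range_facetVertex (hX1 : ∀ y ∈ X, ‖y‖ = 1) {c : E3} (hc : c ≠ 0) :
    (Finset.range (facetAngles X c hc).card).image (facetVertex X c hc) = tightSet X c := by
  apply Finset.coe_injective
  rw [Finset.coe_image, Finset.coe_range, image_facetVertex hX1 hc]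

/-- The enumeration is injective on its range of indices. [folklore] -/
theorem facetVertex_injOn {c : E3} (hc : c ≠ 0) :
    Set.InjOn (facetVertex X c hc) (Finset.range (facetAngles X c hc).card : Set ℕ) := by
  intro i hi j hj h
  have hi' := Finset.mem_range.1 (Finset.mem_coe.1 hi)
  have hj' := Finset.mem_range.1 (Finset.mem_coe.1 hj)
  by_contra hne
  rcases Nat.lt_or_gt_of_ne hne with hlt | hlt
  · exact (signedAzimuth_facetVertex_lt hc hlt hj').ne (by rw [h])
  · exact (signedAzimuth_facetVertex_lt hc hlt hi').ne (by rw [h])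

/-- **The facet vertices are in convex position, counter-clockwise**: all cyclically ordered
triples are positively oriented. [folklore] -/
theorem orient3_facetVertex_pos (hX1 : ∀ y ∈ X, ‖y‖ = 1) {c : E3} (hcF : c ∈ facetNormals X)
    {i j k : ℕ} (hij : i < j) (hjk : j < k)
    (hk : k < (facetAngles X c (ne_zero_of_mem_facetNormals hX1 hcF)).card) :
    0 < orient3 (facetVertex X c (ne_zero_of_mem_facetNormals hX1 hcF) i)
      (facetVertex X c (ne_zero_of_mem_facetNormals hX1 hcF) j)
      (facetVertex X c (ne_zero_of_mem_facetNormals hX1 hcF) k) := by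
  set hc := ne_zero_of_mem_facetNormals hX1 hcF
  have hnorm := one_lt_norm_of_mem_facetNormals hX1 hcF
  have hκpos : 0 < ‖c‖⁻¹ := inv_pos.2 (lt_trans zero_lt_one hnorm)
  have hκlt : ‖c‖⁻¹ < 1 := inv_lt_one_of_one_lt₀ hnorm
  have hρpos : 0 < 1 - ‖c‖⁻¹ ^ 2 := by nlinarith
  rw [orient3_of_tight hX1 hc (facetVertex_mem hc (by omega)) (facetVertex_mem hc (by omega))
    (facetVertex_mem hc hk)]
  -- pass to signed azimuths
  set σ := facetSign c hc with hσ
  set Δ := orient3 (facetFrame c hc 0) (facetFrame c hc 1) (facetFrame c hc 2)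
  set t₁ := azimuth (facetAxis c) (norm_facetAxis hc) (facetVertex X c hc i)
  set t₂ := azimuth (facetAxis c) (norm_facetAxis hc) (facetVertex X c hc j)
  set t₃ := azimuth (facetAxis c) (norm_facetAxis hc) (facetVertex X c hc k)
  have hs₁ : signedAzimuth c hc (facetVertex X c hc i) = σ * t₁ := rfl
  have hs₂ : signedAzimuth c hc (facetVertex X c hc j) = σ * t₂ := rfl
  have hs₃ : signedAzimuth c hc (facetVertex X c hc k) = σ * t₃ := rfl
  have h12 : σ * t₁ < σ * t₂ := hs₁ ▸ hs₂ ▸ signedAzimuth_facetVertex_lt hc hij (lt_trans hjk hk)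
  have h23 : σ * t₂ < σ * t₃ := hs₂ ▸ hs₃ ▸ signedAzimuth_facetVertex_lt hc hjk hk
  have h31 : σ * t₃ < σ * t₁ + 2 * π := by
    have := signedAzimuth_sub_lt c hc (facetVertex X c hc k) (facetVertex X c hc i)
    rw [hs₃, hs₁] at this
    linarith
  have hS : 0 < sin (σ * t₂ - σ * t₁) + sin (σ * t₃ - σ * t₂) - sin (σ * t₃ - σ * t₁) :=
    circleDet_pos h12 h23 h31
  have hσΔ : 0 < σ * Δ := facetSign_mul_orient3_pos c hc
  -- `S(t) = σ S(σ t)`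
  have hodd : sin (t₂ - t₁) + sin (t₃ - t₂) - sin (t₃ - t₁) =
      σ * (sin (σ * t₂ - σ * t₁) + sin (σ * t₃ - σ * t₂) - sin (σ * t₃ - σ * t₁)) :=
    circleDet_signed σ t₁ t₂ t₃ (facetSign_eq_or c hc)
  rw [hodd]
  have : ‖c‖⁻¹ * (1 - ‖c‖⁻¹ ^ 2) *
      (σ * (sin (σ * t₂ - σ * t₁) + sin (σ * t₃ - σ * t₂) - sin (σ * t₃ - σ * t₁))) * Δ =
      ‖c‖⁻¹ * (1 - ‖c‖⁻¹ ^ 2) *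
        (sin (σ * t₂ - σ * t₁) + sin (σ * t₃ - σ * t₂) - sin (σ * t₃ - σ * t₁)) * (σ * Δ) := by
    ring
  rw [this]
  positivity

end Facets

/-! ### Part 3. The facet cone is the polygonal cone of its vertices -/

section FacetCone

variable {X : Finset E3}

/-- **The cone over a facet of the hull of a spherical code is the convex polygonal cone of its
vertices in counter-clockwise order.** [folklore] -/
theorem argmaxCone_eq_polyCone (hX1 : ∀ y ∈ X, ‖y‖ = 1)
    (h0 : (0 : E3) ∈ interior (convexHull ℝ (X : Set E3))) {c : E3} (hcF : c ∈ facetNormals X) :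
    argmaxCone (facetNormals X) c =
      polyCone (facetAngles X c (ne_zero_of_mem_facetNormals hX1 hcF)).card
        (facetVertex X c (ne_zero_of_mem_facetNormals hX1 hcF)) := by
  set hc := ne_zero_of_mem_facetNormals hX1 hcF
  have hm : 3 ≤ (facetAngles X c hc).card := by
    rw [card_facetAngles hX1 hc]; exact three_le_card_tightSet hcF
  rw [polyCone_eq_coneOver hm (fun i j k hij hjk hk => orient3_facetVertex_pos hX1 hcF hij hjk hk),
    image_facetVertex hX1 hc, argmaxCone_facetNormals_eq h0 hcF]
  rfl

/-- **Girard for a facet, vertex form**: the solid-angle fraction of the facet cone is half the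
sum over its vertices of the tangent-wedge fractions, minus `(m − 2)/4`. [folklore] -/
theorem ballFraction_argmaxCone_facet (hX1 : ∀ y ∈ X, ‖y‖ = 1)
    (h0 : (0 : E3) ∈ interior (convexHull ℝ (X : Set E3))) {c : E3} (hcF : c ∈ facetNormals X) :
    ballFraction (0 : E3) (argmaxCone (facetNormals X) c) =
      (1 / 2) * ∑ y ∈ tightSet X c,
          ballFraction (0 : E3) (dirCone (argmaxCone (facetNormals X) c) y) -
        ((tightSet X c).card - 2) / 4 := by
  classical
  set hc := ne_zero_of_mem_facetNormals hX1 hcF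
  have hm : 3 ≤ (facetAngles X c hc).card := by
    rw [card_facetAngles hX1 hc]; exact three_le_card_tightSet hcF
  have hw := fun i j k (hij : i < j) (hjk : j < k) (hk : k < (facetAngles X c hc).card) =>
    orient3_facetVertex_pos hX1 hcF hij hjk hk
  rw [argmaxCone_eq_polyCone hX1 h0 hcF, ballFraction_polyCone_eq_sum_dirCone hm hw,
    ← card_facetAngles hX1 hc, ← image_range_facetVertex hX1 hc,
    Finset.sum_image (facetVertex_injOn hc)]

end FacetCone

/-! ### Part 4. Legendre's identity -/

section Euler

variable {X : Finset E3}

/-- Points of a spherical code are not interior points of its hull. [folklore] -/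
theorem not_mem_interior_convexHull (hX1 : ∀ y ∈ X, ‖y‖ = 1) {y : E3} (hy : y ∈ X) :
    y ∉ interior (convexHull ℝ (X : Set E3)) := by
  have hsub : convexHull ℝ (X : Set E3) ⊆ closedBall 0 1 := by
    refine convexHull_min (fun z hz => ?_) (convex_closedBall 0 1)
    rw [mem_closedBall, dist_zero_right, hX1 z (Finset.mem_coe.1 hz)]
  intro h
  have := interior_mono hsub h
  rw [interior_closedBall 0 one_ne_zero, mem_ball, dist_zero_right, hX1 y hy] at this
  exact lt_irrefl _ this

/-- **Every point of the code is a vertex of some facet.** [folklore] -/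
theorem exists_mem_facetNormals_tight (hX1 : ∀ y ∈ X, ‖y‖ = 1)
    (h0 : (0 : E3) ∈ interior (convexHull ℝ (X : Set E3))) {y : E3} (hy : y ∈ X) :
    ∃ c ∈ facetNormals X, ⟪c, y⟫ = 1 :=
  exists_inner_eq_one_of_not_mem_interior h0 (subset_convexHull ℝ _ (Finset.mem_coe.2 hy))
    (not_mem_interior_convexHull hX1 hy)

open Classical in
/-- **The angles at a vertex sum to `2π`**: the tangent-wedge fractions of the facet cones
through `y ∈ X` sum to `1`. [folklore] -/
theorem sum_ballFraction_dirCone_vertex (hX1 : ∀ y ∈ X, ‖y‖ = 1)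
    (h0 : (0 : E3) ∈ interior (convexHull ℝ (X : Set E3))) {y : E3} (hy : y ∈ X) :
    ∑ c ∈ (facetNormals X).filter (fun c => ⟪c, y⟫ = 1),
        ballFraction (0 : E3) (dirCone (argmaxCone (facetNormals X) c) y) = 1 := by
  refine sum_ballFraction_dirCone_argmaxCone (facetNormals X) _ y (facetNormals_nonempty h0)
    fun c => ?_
  rw [Finset.mem_filter]
  constructor
  · rintro ⟨hc, h1⟩
    exact ⟨hc, (mem_argmaxCone_facetNormals_iff (subset_convexHull ℝ _ (Finset.mem_coe.2 hy))
      (exists_mem_facetNormals_tight hX1 h0 hy) hc).2 h1⟩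
  · rintro ⟨hc, h1⟩
    exact ⟨hc, (mem_argmaxCone_facetNormals_iff (subset_convexHull ℝ _ (Finset.mem_coe.2 hy))
      (exists_mem_facetNormals_tight hX1 h0 hy) hc).1 h1⟩

/-- **Legendre's identity (Euler's formula for the hull of a spherical code).**  For a finite
set `X` of unit vectors of `ℝ³` with `0` in the interior of `conv X`, summing the numbers of
vertices of the facets of `conv X` gives `2·#X + 2·#facets − 4`; with `I = 2E` this is
`V − E + F = 2`. [cite: MusinTarasov2012, §3.1, Prop. 3.4 ("Using Euler's formula")] -/
theorem sum_card_tightSet_eq (hX1 : ∀ y ∈ X, ‖y‖ = 1)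
    (h0 : (0 : E3) ∈ interior (convexHull ℝ (X : Set E3))) :
    ∑ c ∈ facetNormals X, ((tightSet X c).card : ℝ) =
      2 * X.card + 2 * (facetNormals X).card - 4 := by
  classical
  set F := facetNormals X with hF
  set g : E3 → E3 → ℝ := fun c y => ballFraction (0 : E3) (dirCone (argmaxCone F c) y) with hg
  -- (1) the facet cones tile
  have h1 : ∑ c ∈ F, ballFraction (0 : E3) (argmaxCone F c) = 1 :=
    sum_ballFraction_argmaxCone F (facetNormals_nonempty h0)
  -- (2) Girard per facet
  have h2 : ∀ c ∈ F, ballFraction (0 : E3) (argmaxCone F c) =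
      (1 / 2) * ∑ y ∈ tightSet X c, g c y - ((tightSet X c).card - 2) / 4 :=
    fun c hc => ballFraction_argmaxCone_facet hX1 h0 hc
  -- (3) swap the double sum and use the vertex sums
  have h3 : ∑ c ∈ F, ∑ y ∈ tightSet X c, g c y = X.card := by
    rw [Finset.sum_comm' (t' := X) (s' := fun y => F.filter fun c => ⟪c, y⟫ = 1)
      (fun c y => by
        rw [mem_tightSet, Finset.mem_filter]
        tauto)]
    rw [Finset.sum_congr rfl fun y hy => sum_ballFraction_dirCone_vertex hX1 h0 hy]
    simp
  rw [Finset.sum_congr rfl h2, Finset.sum_sub_distrib, ← Finset.mul_sum, h3,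
    ← Finset.sum_div, Finset.sum_sub_distrib] at h1
  simp only [Finset.sum_const, nsmul_eq_mul] at h1
  linarith

/-- **At most `2N − 4` facets** (each facet has at least three vertices). [folklore] -/
theorem card_facetNormals_le (hX1 : ∀ y ∈ X, ‖y‖ = 1)
    (h0 : (0 : E3) ∈ interior (convexHull ℝ (X : Set E3))) :
    (facetNormals X).card + 4 ≤ 2 * X.card := by
  have h := sum_card_tightSet_eq hX1 h0
  have h3 : ∑ c ∈ facetNormals X, (3 : ℝ) ≤ ∑ c ∈ facetNormals X, ((tightSet X c).card : ℝ) :=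
    Finset.sum_le_sum fun c hc => by exact_mod_cast three_le_card_tightSet hc
  rw [Finset.sum_const, nsmul_eq_mul, h] at h3
  have : ((facetNormals X).card : ℝ) + 4 ≤ 2 * X.card := by linarith
  exact_mod_cast this

/-- **Exactly `2N − 4` facets when all facets are triangles** (simplicial hull, e.g. a code in
general position: Fejes Tóth's count of Delaunay triangles). [folklore] -/
theorem card_facetNormals_eq_of_simplicial (hX1 : ∀ y ∈ X, ‖y‖ = 1)
    (h0 : (0 : E3) ∈ interior (convexHull ℝ (X : Set E3)))
    (htri : ∀ c ∈ facetNormals X, (tightSet X c).card = 3) :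
    (facetNormals X).card + 4 = 2 * X.card := by
  have h := sum_card_tightSet_eq hX1 h0
  rw [Finset.sum_congr rfl fun c hc => by rw [htri c hc], Finset.sum_const, nsmul_eq_mul] at h
  have : ((facetNormals X).card : ℝ) + 4 = 2 * X.card := by push_cast at h ⊢; linarith
  exact_mod_cast this

/-- **At most `6N − 12` vertex–facet incidences** (`2E ≤ 6N − 12`). [folklore] -/
theorem sum_card_tightSet_le (hX1 : ∀ y ∈ X, ‖y‖ = 1)
    (h0 : (0 : E3) ∈ interior (convexHull ℝ (X : Set E3))) :
    ∑ c ∈ facetNormals X, (tightSet X c).card + 12 ≤ 6 * X.card := by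
  have h := sum_card_tightSet_eq hX1 h0
  have hF := card_facetNormals_le hX1 h0
  have hF' : ((facetNormals X).card : ℝ) + 4 ≤ 2 * X.card := by exact_mod_cast hF
  have : ∑ c ∈ facetNormals X, ((tightSet X c).card : ℝ) + 12 ≤ 6 * X.card := by linarith
  exact_mod_cast this

end Euler

end Literature.Geometry.DiscreteGeometry
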